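import Literature.ComputerArithmetic.Shewchuk1997.Compress
import Literature.ComputerArithmetic.Shewchuk1997.TwoDiff
import Literature.ComputerArithmetic.BoldoJeannerodMelquiondMuller2023.CorrectRoundingHalfUlp
import Mathlib.Tactic.Linarith
import Mathlib.Tactic.Positivity
import Mathlib.Tactic.Ring
import Mathlib.Tactic.NormNum

/-!
# ROUND-EXPANSION: the correctly rounded value of a nonoverlapping expansion (new work)

An expansion `h` represents `Σ h` exactly, but reading off a single float is lossy: the largest
component of a COMPRESSed expansion is only within `ulp` of the sum (Shewchuk, Theorem 23), and
so is APPROXIMATE(h) = the floating-point sum of the components; neither is the correctly rounded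
value `fl (Σ h)` in general (`p = 3`: `h = [1/4, 2, 16]` has `Σ h = 18.25`, `fl(Σ h) = 20`, top
component `16`; `h = [1/16, 7/4, 20]` has `fl(Σ h) = 20` but APPROXIMATE `= fl(20 + 2) = 24`
under ties-to-even).  ROUND-EXPANSION (`roundExpansion`) returns `fl (Σ h)` itself, for the
working round-to-nearest `fl` with ANY tie-breaking rule, at the cost of one test and three
floating-point operations on the last three components `r₃, r, L` of `h`:
if `r` is an integer multiple of `ulp(L)/4` (the only positions where the rest of the expansion
can influence the rounding of `L + r`), nudge `r` by one `ulp(r)` towards the side of `r₃`; then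
round `L + r`.  The main theorem `roundExpansion_eq_fl_sum` proves this on the class of
expansions of nonzero floats that are nonoverlapping and satisfy the ROUNDOFF CONDITION on their
last two components: `|r| ≤ ulp(L)/2`, sharpened to `ulp(L)/4` when `|L| = 2^j ≥ 2^(emin+p)` is a
power of two and `r` points towards zero — the condition satisfied by a rounding error `r` of a
round-to-nearest addition with result `L`, in particular by the output of COMPRESS (whose last
component is the rounded sum of the one before and a carry), for every precision `p ≥ 2`.
The proof is a case analysis on the position of the lowest set bit `2^a` of `r` relative to
`ulp(L) = 2^k` (`a ≤ k-3`: no nudge, both `L + r` and `Σ h` round to `L`; `a = k-1, k-2`: `r` is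
`±ulp(L)/2, ±ulp(L)/4`, the nudged argument and `Σ h` lie strictly inside the same half-ulp
neighbourhood of the float `L` or `L + 2r`), discharged with the half-ulp criterion
`fl_eq_of_abs_sub_lt_half_ulp` [cite: BoldoEtAl2023, Property 2.7 (consequence)].

HONEST FRAMING.  New work of this project, not the formalisation of a published theorem: the
algorithm, the roundoff condition and the theorem are ours; Shewchuk's paper stops at COMPRESS
and APPROXIMATE [cite: Shewchuk1997, §2.8 p. 323].  Supporting evidence before the proof: an
exhaustive model (all nonoverlapping inputs of `≤ 4..6` components over small exponent ranges,
`p = 2, 3, 4`, four tie-breaking rules, `> 700 000` cases) found no failure of the rule applied to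
COMPRESS output, while the top component / APPROXIMATE differ from `fl(Σ h)` in `2–13 %` of them.
-/

namespace Summit.Ventures.CertifiedArithmetic.Expansions

open Literature.ComputerArithmetic.JeannerodRump2018
open Literature.ComputerArithmetic.BoldoJeannerodMelquiondMuller2023
open Literature.ComputerArithmetic.Shewchuk1997

variable {p : ℕ} {emin : ℤ} {fl : ℚ → ℚ}

open Classical in
/-- **ROUND-EXPANSION.**  Input: an expansion `h` (smallest component first) and the working
round-to-nearest `fl`.  With `L` the last component, `r` the one before it and `r₃` the one before
that: if `r` is an integer multiple of `ulp(L)/4`, replace `r` by `r + sign(r₃)·ulp(r)` (a one-ulp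
step of `r` towards the side the rest of the expansion lies on); return `fl (L + r)`.
Lists of length `0, 1, 2` return `0`, `L`, `fl (L + r)`. -/
noncomputable def roundExpansion (p : ℕ) (emin : ℤ) (fl : ℚ → ℚ) (h : List ℚ) : ℚ :=
  match h.reverse with
  | [] => 0
  | [L] => L
  | [L, r] => fl (L + r)
  | L :: r :: r₃ :: _ =>
    if ∃ z : ℤ, 4 * r = z * ulp p emin L then
      fl (L + (r + (if 0 < r₃ then ulp p emin r else -ulp p emin r)))
    else fl (L + r)

/-! ### Signs and absolute values -/

/-- `|a + b| = |a| + |b|` or `|a + b| = |a| - |b|` when `|b| ≤ |a|`. -/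
private theorem abs_add_eq_or {a b : ℚ} (h : |b| ≤ |a|) :
    |a + b| = |a| + |b| ∨ |a + b| = |a| - |b| := by
  rcases le_or_gt 0 a with ha | ha <;> rcases le_or_gt 0 b with hb | hb
  · left; rw [abs_of_nonneg ha, abs_of_nonneg hb, abs_of_nonneg (by linarith)]
  · right; rw [abs_of_nonneg ha, abs_of_neg hb] at *; rw [abs_of_nonneg (by linarith)]; ring
  · right; rw [abs_of_neg ha, abs_of_nonneg hb] at *; rw [abs_of_nonpos (by linarith)]; ring
  · left; rw [abs_of_neg ha, abs_of_neg hb, abs_of_neg (by linarith)]; ring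

/-- Same signs: if `0 < a ↔ 0 < b`, `b ≠ 0` and `|a| ≤ |b|` then `|b - a| = |b| - |a|`. -/
private theorem abs_sub_of_sameSign {a b : ℚ} (hs : 0 < a ↔ 0 < b) (hb : b ≠ 0)
    (h : |a| ≤ |b|) : |b - a| = |b| - |a| := by
  rcases lt_or_gt_of_ne hb with hb | hb
  · have ha : a ≤ 0 := not_lt.mp fun ha => absurd (hs.mp ha) (by linarith)
    rw [abs_of_neg hb, abs_of_nonpos ha] at *; rw [abs_of_nonpos (by linarith)]; ring
  · rcases (show 0 < a ∨ a = 0 by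
        rcases lt_trichotomy 0 a with h' | h' | h'
        exacts [Or.inl h', Or.inr h'.symm, absurd (hs.mpr hb) (by linarith)]) with ha | rfl
    · rw [abs_of_pos hb, abs_of_pos ha] at *; rw [abs_of_nonneg (by linarith)]
    · simp

/-- Opposite signs: if `0 < a ↔ b < 0` and `a ≠ 0` then `|b + a| = | |b| - |a| |`. -/
private theorem abs_add_of_oppSign {a b : ℚ} (hs : 0 < a ↔ b < 0) (ha : a ≠ 0) :
    |b + a| = |(|b| - |a|)| := by
  rcases lt_or_gt_of_ne ha with ha | ha
  · have hb : 0 ≤ b := not_lt.mp fun hb => absurd (hs.mpr hb) (by linarith)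
    rw [abs_of_neg ha, abs_of_nonneg hb, show b - -a = b + a by ring]
  · rw [abs_of_pos ha, abs_of_neg (hs.mp ha), show -b - a = -(b + a) by ring, abs_neg]

/-- If `r` points towards zero from `L` (`|L + r| = |L| - |r|`, `2|r| ≤ |L|`), so does `2r`. -/
private theorem abs_add_of_toward {L r : ℚ} (h : |L + r| = |L| - |r|) (hr : r ≠ 0)
    (h2 : 2 * |r| ≤ |L|) : |L + 2 * r| = |L| - 2 * |r| := by
  rcases lt_or_gt_of_ne hr with hr' | hr' <;> rcases le_or_gt 0 L with hL | hL
  · rw [abs_of_neg hr'] at *; rw [abs_of_nonneg hL] at *; rw [abs_of_nonneg (by linarith)]; ring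
  · rw [abs_of_neg hr', abs_of_neg hL, abs_of_neg (by linarith)] at h; linarith
  · rw [abs_of_pos hr', abs_of_nonneg hL, abs_of_nonneg (by linarith)] at h; linarith
  · rw [abs_of_pos hr'] at *; rw [abs_of_neg hL] at *; rw [abs_of_nonpos (by linarith)]; ring

/-! ### The ulp just below a float -/

/-- Within `ulp(L)/2` below a nonzero float `L` the ulp is still `≥ ulp(L)/2`. -/
private theorem half_ulp_le_ulp (hp : 1 ≤ p) {L x : ℚ} (hL0 : L ≠ 0)
    (hx : |L| - ulp p emin L / 2 ≤ |x|) : ulp p emin L / 2 ≤ ulp p emin x := by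
  have h2 : (0:ℚ) < 2 := by norm_num
  rcases le_or_gt (Int.log 2 |L| - p + 1) emin with hle | hgt
  · rw [ulp_of_ne_zero hL0, max_eq_left hle]
    linarith [two_zpow_emin_le_ulp (p := p) (emin := emin) x, zpow_pos h2 emin]
  · set E := Int.log 2 |L|
    have hu : ulp p emin L = 2 ^ (E - p + 1) := by rw [ulp_of_ne_zero hL0, max_eq_right hgt.le]
    have h1 : (2 : ℚ) ^ (E - p + 1) ≤ 2 ^ E := zpow_le_zpow_right₀ (by norm_num) (by omega)
    have := two_zpow_le_ulp_of_le_abs (p := p) (emin := emin) (E - 1) (t := x)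
      (by rw [zpow_sub_one₀ h2.ne']; linarith [zpow_log_le_abs hL0])
    rw [hu, show E - p + 1 = (E - 1 - p + 1) + 1 by ring, zpow_add_one₀ h2.ne']
    linarith

/-- If `|L|` is not a power of two `2^j` with `j ≥ emin + p` (so that the floats just below `|L|`
are still `ulp L` apart), then `|x| > |L| − ulp L` gives `ulp x ≥ ulp L`. -/
private theorem ulp_le_ulp_of_not_pow (hp : 1 ≤ p) {L x : ℚ} (hL : IsFloat p emin L)
    (hL0 : L ≠ 0) (hnp : ¬ ∃ j : ℤ, emin + p ≤ j ∧ |L| = 2 ^ j)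
    (hx : |L| - ulp p emin L < |x|) : ulp p emin L ≤ ulp p emin x := by
  have h2 : (0:ℚ) < 2 := by norm_num
  rcases le_or_gt (Int.log 2 |L| - p + 1) emin with hle | hgt
  · rw [ulp_of_ne_zero hL0, max_eq_left hle]; exact two_zpow_emin_le_ulp x
  · set E := Int.log 2 |L|
    have hu : ulp p emin L = 2 ^ (E - p + 1) := by rw [ulp_of_ne_zero hL0, max_eq_right hgt.le]
    rw [hu]
    refine two_zpow_le_ulp_of_le_abs E ?_
    -- `|L| ≥ 2^E`, `|L| ≠ 2^E`, and both are multiples of `ulp L`: so `|L| ≥ 2^E + ulp L`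
    obtain ⟨K, hK⟩ := exists_eq_int_mul_ulp_of_isFloat (p := p) (emin := emin) hL
    have hKabs : |L| = |(K : ℚ)| * 2 ^ (E - p + 1) := by
      conv_lhs => rw [hK]
      rw [abs_mul, hu, abs_of_pos (zpow_pos h2 _)]
    have h2E : (2 : ℚ) ^ E = (((2 : ℤ) ^ (p - 1) : ℤ) : ℚ) * 2 ^ (E - p + 1) := by
      push_cast
      rw [← zpow_natCast, Nat.cast_sub hp, ← zpow_add₀ h2.ne']
      push_cast; congr 1; ring
    have hlt : (((2 : ℤ) ^ (p - 1) : ℤ) : ℚ) < |(K : ℚ)| := by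
      refine lt_of_mul_lt_mul_right ?_ (zpow_pos h2 (E - p + 1)).le
      rw [← h2E, ← hKabs]
      exact lt_of_le_of_ne (zpow_log_le_abs hL0) fun h => hnp ⟨E, by omega, h.symm⟩
    have hle : (((2 : ℤ) ^ (p - 1) : ℤ) : ℚ) + 1 ≤ |(K : ℚ)| := by
      rw [← Int.cast_abs] at hlt ⊢; exact_mod_cast hlt
    have := mul_le_mul_of_nonneg_right hle (zpow_pos h2 (E - p + 1)).le
    rw [add_mul, one_mul, ← h2E, ← hKabs] at this
    linarith

/-- In a nonoverlapping expansion of floats ending in `M·2^a` with `M` odd, the earlier components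
sum to less than `2^a` in magnitude. -/
private theorem abs_sum_lt_of_odd {l₀ : List ℚ} {M a : ℤ} (hl : ∀ x ∈ l₀, IsFloat p emin x)
    (hMo : Odd M) (hexp : IsExpansion 1 (l₀ ++ [(M : ℚ) * 2 ^ a])) : |l₀.sum| < (2 : ℚ) ^ a := by
  have hpw := List.pairwise_append.mp hexp
  refine abs_sum_lt_two_zpow_of_isExpansion hl hpw.1 fun x hx => ?_
  obtain ⟨s, hs, hxs⟩ := hpw.2.2 x hx _ (List.mem_singleton_self _)
  rw [one_mul] at hxs
  exact lt_of_lt_of_le hxs (zpow_le_zpow_right₀ (by norm_num) (OnGrid.le_of_odd hMo hs))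

/-! ### The theorem -/

/-- **ROUND-EXPANSION IS CORRECT ROUNDING** on the class of expansions `h` of nonzero floats that
are nonoverlapping and whose last two components `r, L` satisfy the ROUNDOFF CONDITION:
`|r| ≤ ulp(L)/2`, sharpened to `ulp(L)/4` when `|L| = 2^j ≥ 2^(emin+p)` is a power of two and `r`
points towards zero (what holds when `r` is the error of a rounding to nearest whose result is
`L`).  Then, for every precision `p ≥ 2` and every round-to-nearest `fl` (any tie-breaking rule),
`roundExpansion fl h = fl (Σ h)`, the correctly rounded value of the represented number. -/
theorem roundExpansion_eq_fl_sum (hp : 2 ≤ p) (hfl : IsRoundNearest p emin fl) {h : List ℚ}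
    (hh : ∀ x ∈ h, IsFloat p emin x) (hnz : ∀ x ∈ h, x ≠ 0) (hexp : IsExpansion 1 h)
    (hnear : ∀ L r t, h.reverse = L :: r :: t → |r| ≤ ulp p emin L / 2 ∧
      ((∃ j : ℤ, emin + p ≤ j ∧ |L| = 2 ^ j) → |L + r| < |L| → |r| ≤ ulp p emin L / 4)) :
    roundExpansion p emin fl h = fl h.sum := by
  have hp1 : 1 ≤ p := by omega
  have h2 : (0 : ℚ) < 2 := by norm_num
  rcases hrev : h.reverse with _ | ⟨L, _ | ⟨r, _ | ⟨r₃, t⟩⟩⟩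
  · have : h = [] := List.reverse_eq_nil_iff.mp hrev
    subst this; simp [roundExpansion, fl_zero hfl]
  · have : h = [L] := by rw [← List.reverse_reverse h, hrev]; rfl
    subst this; simp [roundExpansion, fl_eq_self hfl (hh L (by simp))]
  · have : h = [r, L] := by rw [← List.reverse_reverse h, hrev]; rfl
    subst this; simp [roundExpansion, add_comm]
  -- three or more components: `h = l₀ ++ [r, L]`, `l₀ = … ++ [r₃]`, `ρ = Σ l₀`
  have hh' : h = t.reverse ++ [r₃] ++ [r] ++ [L] := by rw [← List.reverse_reverse h, hrev]; simp
  set l₀ := t.reverse ++ [r₃] with hl₀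
  have hmem : ∀ x, x ∈ l₀ ∨ x = r ∨ x = L → x ∈ h := by
    intro x hx; rw [hh']; simp only [List.mem_append, List.mem_singleton, hl₀] at hx ⊢; tauto
  have hl₀F : ∀ x ∈ l₀, IsFloat p emin x := fun x hx => hh x (hmem x (Or.inl hx))
  have htF : ∀ x ∈ t.reverse, IsFloat p emin x := fun x hx => hl₀F x (List.mem_append_left _ hx)
  have hr3F : IsFloat p emin r₃ := hl₀F r₃ (by simp [hl₀])
  have hrF : IsFloat p emin r := hh r (hmem r (Or.inr (Or.inl rfl)))
  have hLF : IsFloat p emin L := hh L (hmem L (Or.inr (Or.inr rfl)))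
  have hr30 : r₃ ≠ 0 := hnz r₃ (hmem r₃ (Or.inl (by simp [hl₀])))
  have hr0 : r ≠ 0 := hnz r (hmem r (Or.inr (Or.inl rfl)))
  have hL0 : L ≠ 0 := hnz L (hmem L (Or.inr (Or.inr rfl)))
  have hsum : h.sum = L + r + l₀.sum := by rw [hh']; simp [hl₀]; ring
  set ρ := l₀.sum with hρ
  have hexp3 : IsExpansion 1 (l₀ ++ [r]) :=
    hexp.sublist (by rw [hh']; exact List.sublist_append_left _ _)
  have hsg :=
    sum_pos_iff_of_isExpansion htF hr3F hr30 (hexp3.sublist (List.sublist_append_left _ _))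
  rw [← hl₀] at hsg
  have hρ0 : ρ ≠ 0 := by
    intro h0
    rcases lt_or_gt_of_ne hr30 with h3 | h3
    · have := hsg.2.mpr h3; rw [← hρ, h0] at this; exact lt_irrefl _ this
    · have := hsg.1.mpr h3; rw [← hρ, h0] at this; exact lt_irrefl _ this
  -- `r = M·2^a` with `M` odd; the rest is `< 2^a`, hence `a > emin`
  obtain ⟨M, a, hMo, -, -, hrMa⟩ := exists_odd_mul_two_zpow hrF hr0
  have h2a : (0 : ℚ) < 2 ^ a := zpow_pos h2 _
  have hρlt : |ρ| < 2 ^ a := by rw [hrMa] at hexp3; exact abs_sum_lt_of_odd hl₀F hMo hexp3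
  have hae : emin < a := by
    have hge : (2 : ℚ) ^ emin ≤ |ρ| :=
      OnGrid.two_zpow_le_abs (OnGrid.listSum fun x hx => OnGrid.of_isFloat (hl₀F x hx)) hρ0
    by_contra hle
    have : (2 : ℚ) ^ a ≤ 2 ^ emin := zpow_le_zpow_right₀ (by norm_num) (not_lt.mp hle)
    linarith
  have hM0 : M ≠ 0 := by rintro rfl; obtain ⟨j, hj⟩ := hMo; omega
  have hM1 : (1 : ℚ) ≤ |(M : ℚ)| := by rw [← Int.cast_abs]; exact_mod_cast Int.one_le_abs hM0
  have hrabs : |r| = |(M : ℚ)| * 2 ^ a := by rw [hrMa, abs_mul, abs_of_pos h2a]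
  have h2ar : (2 : ℚ) ^ a ≤ |r| := by rw [hrabs]; exact le_mul_of_one_le_left h2a.le hM1
  -- `ulp L = 2^k ≤ |L|`, `L = K·ulp L`, and the roundoff condition
  obtain ⟨k, hk, hu⟩ := exists_ulp_eq_two_zpow (p := p) (emin := emin) L
  have hupos : 0 < ulp p emin L := ulp_pos L
  have huL : ulp p emin L ≤ |L| := ulp_le_abs_of_isFloat hLF hL0
  obtain ⟨K, hK⟩ := exists_eq_int_mul_ulp_of_isFloat (p := p) (emin := emin) hLF
  have hKlt : |K| < (2 : ℤ) ^ p := by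
    have h := abs_lt_two_pow_mul_ulp (p := p) (emin := emin) L
    rw [show |L| = |(K : ℚ)| * ulp p emin L by
      conv_lhs => rw [hK]
      rw [abs_mul, abs_of_pos hupos]] at h
    have := lt_of_mul_lt_mul_right h hupos.le
    rw [← Int.cast_abs] at this; exact_mod_cast this
  obtain ⟨hrle, hbb⟩ := hnear L r (r₃ :: t) hrev
  have hrL : |r| ≤ |L| := by linarith
  have hk2 : (2 : ℚ) ^ k / 2 = 2 ^ (k - 1) := by rw [zpow_sub_one₀ h2.ne']; ring
  have hk4 : (2 : ℚ) ^ k / 4 = 2 ^ (k - 2) := by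
    rw [show k - 2 = k - 1 - 1 by ring, zpow_sub_one₀ h2.ne', zpow_sub_one₀ h2.ne']; ring
  have hak : a ≤ k - 1 :=
    (zpow_le_zpow_iff_right₀ (by norm_num : (1:ℚ) < 2)).mp (by rw [← hk2, ← hu]; linarith)
  have crit := fun {x c : ℚ} (hc : IsFloat p emin c) (hxc : |x - c| < ulp p emin x / 2) =>
    fl_eq_of_abs_sub_lt_half_ulp hp1 hfl hc hxc
  -- triangle inequalities, and the ulp at arguments close to `L`
  have hxLr : |L| - |r| ≤ |L + r| := by
    have := abs_sub_abs_le_abs_sub L (-r); rw [sub_neg_eq_add, abs_neg] at this; linarith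
  have hx2 : |L + r| - |ρ| ≤ |L + r + ρ| := by
    have := abs_sub_abs_le_abs_sub (L + r) (-ρ); rw [sub_neg_eq_add, abs_neg] at this; linarith
  have hulp : ¬ ((∃ j : ℤ, emin + p ≤ j ∧ |L| = 2 ^ j) ∧ |L + r| = |L| - |r|) →
      ∀ x, |L + r| - |r| < |x| → ulp p emin L ≤ ulp p emin x := by
    intro hn x hx
    rcases abs_add_eq_or hrL with haway | htow
    · exact ulp_mono (by linarith)
    · exact ulp_le_ulp_of_not_pow hp1 hLF hL0 (fun hj => hn ⟨hj, htow⟩) (by linarith)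
  simp only [roundExpansion, hrev]
  rcases lt_or_ge a (k - 2) with hlt | hge
  · ----------------------------------------------------------------- (I) `a ≤ k - 3`: no nudge
    have hoff : ∀ d, a < d → ¬ OnGrid d r := fun d hd hg =>
      absurd (OnGrid.le_of_odd hMo (by rw [← hrMa]; exact hg)) (by omega)
    rw [if_neg fun ⟨z, hz⟩ => hoff (k - 2) (by omega) ⟨z, by rw [← hk4, ← hu]; linarith⟩]
    -- both roundings give `L` as soon as `v ≤ ulp` at both arguments and `|r| + |ρ| < v/2`
    have fin : ∀ v, v ≤ ulp p emin (L + r) → v ≤ ulp p emin (L + r + ρ) → |r| + |ρ| < v / 2 →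
        fl (L + r) = fl h.sum := by
      intro v hv1 hv2 hv
      rw [crit hLF (by rw [show L + r - L = r by ring]; linarith [abs_nonneg ρ]), hsum,
        crit hLF (by rw [show L + r + ρ - L = r + ρ by ring]; linarith [abs_add_le r ρ])]
    -- `|r|` lies on the grid `2^a` but on no coarser one: it is `2^a`-far from `2^(k-2), 2^(k-1)`
    have hga : OnGrid a |r| := (show OnGrid a r from ⟨M, hrMa⟩).abs
    have hne : ∀ d, a < d → |r| ≠ (2 : ℚ) ^ d := fun d hd h => hoff d hd (by
      have hg : OnGrid d |r| := by rw [h]; exact OnGrid.two_zpow le_rfl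
      rcases abs_choice r with h' | h'
      · rwa [h'] at hg
      · rw [h'] at hg; simpa using hg.neg)
    have hgap2 : |r| + 2 ^ a ≤ 2 ^ (k - 1) := hga.add_two_zpow_le (OnGrid.two_zpow (by omega))
      (lt_of_le_of_ne (by rw [← hk2, ← hu]; exact hrle) (hne (k - 1) (by omega)))
    rcases lt_or_gt_of_ne (hne (k - 2) (by omega)) with hlt4 | hgt4
    · -- (I.1) `|r| ≤ ulp L/4 - 2^a`: both arguments lie within `ulp L/4` of `L`
      have hr4 := hga.add_two_zpow_le (OnGrid.two_zpow (by omega)) hlt4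
      exact fin (ulp p emin L / 2) (half_ulp_le_ulp hp1 hL0 (by rw [hu]; linarith))
        (half_ulp_le_ulp hp1 hL0 (by rw [hu]; linarith)) (by rw [hu]; linarith)
    · -- (I.2) `|r| ≥ ulp L/4 + 2^a`: within `ulp L/2` of `L`, where the ulp is `≥ ulp L`
      have hr4 := (OnGrid.two_zpow (by omega)).add_two_zpow_le hga hgt4
      have hn : ¬ ((∃ j : ℤ, emin + p ≤ j ∧ |L| = 2 ^ j) ∧ |L + r| = |L| - |r|) := fun hj => by
        have := hbb hj.1 (by rw [hj.2]; linarith [abs_pos.mpr hr0]); linarith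
      exact fin (ulp p emin L) (hulp hn _ (by linarith [abs_pos.mpr hr0]))
        (hulp hn _ (by linarith)) (by rw [hu]; linarith)
  · --------------------------------------------------- (II)/(III) `a ∈ {k-1, k-2}`: `|M| = 1`
    have hMz : |M| = 1 := by
      have h1 : |(M : ℚ)| * 2 ^ a ≤ 2 * 2 ^ a := by
        have : (2 : ℚ) ^ (k - 1) ≤ 2 * 2 ^ a := by
          rw [show k - 1 = k - 2 + 1 by ring, zpow_add_one₀ h2.ne', mul_comm]
          exact mul_le_mul_of_nonneg_left (zpow_le_zpow_right₀ (by norm_num) hge) h2.le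
        rw [← hrabs]; linarith [hrle]
      have h3 : |M| ≤ 2 := by
        have := le_of_mul_le_mul_right h1 h2a; rw [← Int.cast_abs] at this; exact_mod_cast this
      obtain ⟨j, rfl⟩ := hMo; rcases abs_cases (2 * j + 1) with ⟨h, h'⟩ | ⟨h, h'⟩ <;> omega
    have hr : |r| = 2 ^ a := by
      rw [hrabs, show |(M : ℚ)| = 1 by rw [← Int.cast_abs, hMz]; simp, one_mul]
    have htest : ∃ z : ℤ, 4 * r = z * ulp p emin L := by
      refine ⟨M * 2 ^ (a + 2 - k).toNat, ?_⟩
      rw [hrMa, hu]; push_cast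
      rw [← zpow_natCast, Int.toNat_of_nonneg (by omega), mul_assoc, ← zpow_add₀ h2.ne',
        show a + 2 - k + k = a + 2 by ring, zpow_add₀ h2.ne']
      norm_num; ring
    rw [if_pos htest]
    set δ := ulp p emin r with hδdef
    have hδ : δ ≤ |r| / 2 := by
      have := ulp_le_two_zpow_of_abs_le (emin := emin) hp (u := a - 1) (by omega) (t := r)
        (by rw [hr, zpow_sub_one₀ h2.ne']; linarith)
      rw [zpow_sub_one₀ h2.ne'] at this; rw [hr]; linarith
    have hδpos : 0 < δ := ulp_pos r
    set n := (if 0 < r₃ then δ else -δ) with hndef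
    have hn : |n| = δ ∧ (0 < n ↔ 0 < r₃) := by
      by_cases h3 : 0 < r₃
      · rw [hndef, if_pos h3, abs_of_pos hδpos]; exact ⟨rfl, ⟨fun _ => h3, fun _ => hδpos⟩⟩
      · rw [hndef, if_neg h3, abs_neg, abs_of_pos hδpos]
        exact ⟨rfl, ⟨fun h => absurd h (by linarith), fun h => absurd h h3⟩⟩
    have hx1 : |L + r| - δ ≤ |L + (r + n)| := by
      have := abs_sub_abs_le_abs_sub (L + r) (-n)
      rw [sub_neg_eq_add, abs_neg, hn.1] at this; rw [← add_assoc]; linarith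
    have hn0 : n ≠ 0 := abs_pos.mp (by rw [hn.1]; exact hδpos)
    have hρr : |ρ| ≤ |r| := by rw [hr]; exact hρlt.le
    -- the distances to the two candidates `L + 2r` (rest on the side of `r`) and `L` (opposite)
    have hdist : ∀ y, |y| ≤ |r| → y ≠ 0 →
        ((0 < y ↔ 0 < r) → |r - y| = |r| - |y|) ∧ ((0 < y ↔ r < 0) → |r + y| = |r| - |y|) :=
      fun y hy hy0 => ⟨fun hs => abs_sub_of_sameSign hs hr0 hy,
        fun ho => by rw [abs_add_of_oppSign ho hy0, abs_of_nonneg (by linarith)]⟩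
    -- KEY: either the ulp at both arguments is `≥ 2|r|` and `L + 2r` is a float (cases II and
    -- III-midpoint: then the side of the rest decides), or both lie within `ulp/2` of `L`
    suffices key : (2 * |r| ≤ ulp p emin (L + (r + n)) ∧ 2 * |r| ≤ ulp p emin (L + r + ρ) ∧
        IsFloat p emin (L + 2 * r)) ∨
        (|r| + δ < ulp p emin (L + (r + n)) / 2 ∧ |r| + |ρ| < ulp p emin (L + r + ρ) / 2) by
      rcases key with ⟨hu1, hu2, hc⟩ | ⟨hv1, hv2⟩
      · by_cases hS : (0 < r₃ ↔ 0 < r)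
        · rw [crit hc (by rw [show L + (r + n) - (L + 2 * r) = -(r - n) by ring, abs_neg,
            (hdist n (by linarith) hn0).1 (hn.2.trans hS)]; linarith), hsum,
            crit hc (by rw [show L + r + ρ - (L + 2 * r) = -(r - ρ) by ring, abs_neg,
              (hdist ρ hρr hρ0).1 (hsg.1.trans hS)]; linarith [abs_pos.mpr hρ0])]
        · have hO : (0 < r₃ ↔ r < 0) := by
            rcases lt_or_gt_of_ne hr0 with h | h
            · exact ⟨fun _ => h, fun _ => by
                by_contra h3; exact hS ⟨fun h' => absurd h' h3, fun h' => by linarith⟩⟩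
            · exact ⟨fun h3 => absurd ⟨fun _ => h, fun _ => h3⟩ hS, fun h' => by linarith⟩
          rw [crit hLF (by rw [show L + (r + n) - L = r + n by ring,
            (hdist n (by linarith) hn0).2 (hn.2.trans hO)]; linarith), hsum,
            crit hLF (by rw [show L + r + ρ - L = r + ρ by ring,
              (hdist ρ hρr hρ0).2 (hsg.1.trans hO)]; linarith [abs_pos.mpr hρ0])]
      · rw [crit hLF (by rw [show L + (r + n) - L = r + n by ring]; linarith [abs_add_le r n]),
          hsum, crit hLF (by rw [show L + r + ρ - L = r + ρ by ring]; linarith [abs_add_le r ρ])]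
    rcases (show a = k - 1 ∨ a = k - 2 by omega) with ha | ha
    · --------------------------------------------------------------- (II) `|r| = ulp L / 2`
      have hr2 : 2 * |r| = ulp p emin L := by rw [hr, ha, hu, ← hk2]; ring
      have hn' : ¬ ((∃ j : ℤ, emin + p ≤ j ∧ |L| = 2 ^ j) ∧ |L + r| = |L| - |r|) := fun hj => by
        have := hbb hj.1 (by rw [hj.2]; linarith [abs_pos.mpr hr0]); linarith
      refine Or.inl ⟨?_, ?_, ?_⟩
      · rw [hr2]; exact hulp hn' _ (by linarith [abs_pos.mpr hr0])
      · rw [hr2]; exact hulp hn' _ (by linarith [abs_pos.mpr hρ0, hx2])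
      · -- `L + 2r = (K + M)·ulp L` with `|K + M| ≤ |K| + 1 ≤ 2^p`
        rw [show L + 2 * r = ((K + M : ℤ) : ℚ) * 2 ^ k by
          rw [hK, hrMa, hu, ha, ← hk2]; push_cast; ring]
        exact isFloat_of_abs_le hp1 ((abs_add_le K M).trans (by omega)) hk
    · --------------------------------------------------------------- (III) `|r| = ulp L / 4`
      have hr4 : 4 * |r| = ulp p emin L := by rw [hr, ha, hu, ← hk4]; ring
      by_cases hmid : (∃ j : ℤ, emin + p ≤ j ∧ |L| = 2 ^ j) ∧ |L + r| = |L| - |r|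
      · -- binade bottom, `r` towards zero: `Σ` is within `ulp L/4 = ulp/2` of the midpoint
        -- `L + r` of the consecutive floats `L + 2r`, `L`; the side of the rest decides
        obtain ⟨⟨j, hj, hLj⟩, htow⟩ := hmid
        have hul : ∀ x, |L| - ulp p emin L / 2 ≤ |x| → 2 * |r| ≤ ulp p emin x := fun x hx => by
          have := half_ulp_le_ulp hp1 hL0 hx; linarith
        refine Or.inl ⟨hul _ (by linarith), hul _ (by linarith), ?_⟩
        -- `L + 2r` is on the grid `2^(k-1)` and `|L + 2r| = |L| - 2|r| < |L| = 2^j = 2^(k-1+p)`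
        have huj : ulp p emin L = 2 ^ (j - p + 1) := by
          rw [ulp_of_ne_zero hL0, hLj,
            show Int.log 2 ((2 : ℚ) ^ j) = j by exact_mod_cast Int.log_zpow (R := ℚ) one_lt_two j,
            max_eq_right (by omega)]
        have hkj : k = j - p + 1 := zpow_right_injective₀ h2 (by norm_num) (hu.symm.trans huj)
        have habs : |L + 2 * r| = |L| - 2 * |r| := abs_add_of_toward htow hr0 (by linarith)
        have hgrid : OnGrid (k - 1) (L + 2 * r) :=
          (onGrid_of_two_zpow_le_ulp hLF (by rw [hu, ← hk2]; linarith [zpow_pos h2 k])).add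
            ⟨M, by rw [hrMa, ha, show k - 2 = k - 1 - 1 by ring, zpow_sub_one₀ h2.ne']; ring⟩
        by_contra hnf
        have := two_zpow_le_abs_of_onGrid_of_not_isFloat (p := p) (by omega : emin ≤ k - 1)
          hgrid hnf
        rw [show k - 1 + p = j by omega, ← hLj] at this
        linarith [abs_pos.mpr hr0]
      · -- otherwise both arguments are within `3 ulp L/8 < ulp L/2` of `L`, the ulp `≥ ulp L`
        refine Or.inr ⟨?_, ?_⟩
        · have := hulp hmid _ (show |L + r| - |r| < |L + (r + n)| by linarith [abs_pos.mpr hr0])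
          linarith
        · have := hulp hmid _ (show |L + r| - |r| < |L + r + ρ| by linarith [abs_pos.mpr hρ0])
          linarith

end Summit.Ventures.CertifiedArithmetic.Expansions
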